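import Mathlib.AlgebraicGeometry.ZariskisMainTheorem
import Literature.AlgebraicGeometry.Morphisms.ProjectiveMorphism
import HarnessLib

/-!
# Projectivity from a monomorphism into projective space (proper monomorphisms are closed immersions)

Topic `Literature/AlgebraicGeometry/Morphisms`; sequel of `Morphisms/ProjectiveMorphism`
(`Literature.AlgebraicGeometry.Morphisms.IsProjective f`: Hartshorne's projective morphisms, a
closed immersion into `𝐏(ι; S) = S ×_{Spec ℤ} 𝐏ⁿ_ℤ` followed by the projection). The standard way
to prove that a PROPER `S`-scheme `Y` (e.g. a Grassmannian, via the valuative criterion) is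
projective is to map it injectively-on-points into a projective space (e.g. by Plücker coordinates):
a proper monomorphism is a closed immersion (Stacks Tag 04XV, EGA IV₄ 18.12.6; Mathlib
`IsClosedImmersion.iff_isProper_and_mono`). This file records that reduction in the tree's currency:

* `IsProjective.of_mono_projectiveSpace` — over any base `S`: `j : Y → 𝐏(ι; S)` a monomorphism over
  `S` with `Y → S` proper ⇒ `Y → S` projective.
* `IsProjective.terminal_from_of_isClosedImmersion`, `IsProjective.terminal_from_of_mono` — the
  absolute forms over `Spec ℤ` (the terminal scheme), for a closed immersion, resp. a monomorphism
  from a proper scheme, into `𝐏ⁿ_ℤ = Literature.AlgebraicGeometry.Morphisms.projectiveSpaceInt ι`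
  (`𝐏(ι; ⊤) ≅ 𝐏ⁿ_ℤ`).
* `mono_of_injective_comp` — a morphism of schemes injective on `T`-points for all `T` is a
  monomorphism (the form in which functor-of-points constructions deliver monomorphisms).

Everything is proved; no definitions, no named facts.

## References

* The Stacks Project, Tag 04XV (closed immersion ⟺ proper monomorphism), Tag 01W8 (H-projective).
  [StacksProject]
* A. Grothendieck, *EGA IV₄*, Publ. Math. IHÉS 32 (1967), Cor. 18.12.6. [EGAIV4]
* R. Hartshorne, *Algebraic Geometry*, GTM 52 (1977), II §4 Definition p. 103. [Hartshorne1977]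
-/

noncomputable section

-- Mathlib's pull-back API is stated through `abbrev`s over `limit`; as in Mathlib's own
-- algebraic-geometry files we let `simp`/unification see through them.
set_option backward.isDefEq.respectTransparency false

universe u

open CategoryTheory CategoryTheory.Limits AlgebraicGeometry

namespace Literature.AlgebraicGeometry.Morphisms

namespace IsProjective

variable {Y S : Scheme.{u}} (ι : Type u) [Finite ι]

/-- **A proper `S`-scheme with a monomorphism into a projective space over `S` is projective over
`S`**: `j` is proper (`Y → S` is, and `𝐏(ι; S) → S` is separated), hence a proper monomorphism,
hence a closed immersion (Stacks 04XV). [cite: StacksProject, Tag 04XV] -/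
theorem of_mono_projectiveSpace {f : Y ⟶ S} (j : Y ⟶ projectiveSpace ι S) [Mono j]
    (hj : j ≫ projectiveSpaceFst ι S = f) [IsProper f] : IsProjective f := by
  haveI : IsProper (j ≫ projectiveSpaceFst ι S) := by rw [hj]; infer_instance
  haveI : IsProper j := IsProper.of_comp j (projectiveSpaceFst ι S)
  haveI : IsClosedImmersion j := (IsClosedImmersion.iff_isProper_and_mono j).mpr ⟨inferInstance, ‹_›⟩
  exact ⟨ι, ‹_›, j, inferInstance, hj⟩

omit [Finite ι] in
/-- The second projection `𝐏(ι; ⊤) = ⊤ ×_⊤ 𝐏ⁿ_ℤ → 𝐏ⁿ_ℤ` is an isomorphism. [cite: StacksProject, Tag 01W8] -/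
theorem isIso_projectiveSpace_terminal_snd :
    IsIso (pullback.snd (terminal.from (⊤_ Scheme.{u})) (terminal.from (projectiveSpaceInt ι))) := by
  have h : terminal.from (⊤_ Scheme.{u}) = 𝟙 _ := terminal.hom_ext _ _
  rw [h]
  infer_instance

omit [Finite ι] in
/-- The morphism `Y → 𝐏(ι; ⊤)` with second component a given `j : Y → 𝐏ⁿ_ℤ`. [cite: StacksProject, Tag 01W8] -/
theorem exists_lift_terminal (j : Y ⟶ projectiveSpaceInt ι) :
    ∃ j' : Y ⟶ projectiveSpace ι (⊤_ Scheme.{u}),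
      j' ≫ pullback.snd _ _ = j ∧ j' ≫ projectiveSpaceFst ι _ = terminal.from Y :=
  ⟨pullback.lift (terminal.from Y) j (terminal.hom_ext _ _), pullback.lift_snd _ _ _,
    pullback.lift_fst _ _ _⟩

/-- **A scheme with a closed immersion into `𝐏ⁿ_ℤ` is projective over `Spec ℤ`** (the terminal
scheme): `𝐏(ι; ⊤) ≅ 𝐏ⁿ_ℤ`. [cite: Hartshorne1977, II §4 Definition p.103 (projective morphism)] -/
theorem terminal_from_of_isClosedImmersion (j : Y ⟶ projectiveSpaceInt ι) [IsClosedImmersion j] :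
    IsProjective (terminal.from Y) := by
  obtain ⟨j', hj', hfst⟩ := exists_lift_terminal ι j
  haveI := isIso_projectiveSpace_terminal_snd.{u} ι
  haveI : IsClosedImmersion (j' ≫ pullback.snd (terminal.from (⊤_ Scheme.{u}))
      (terminal.from (projectiveSpaceInt ι))) := by rw [hj']; infer_instance
  haveI : IsClosedImmersion j' :=
    (IsClosedImmersion.comp_iff (f := j') (g := pullback.snd _ _)).mp inferInstance
  exact ⟨ι, ‹_›, j', inferInstance, hfst⟩

/-- **A proper scheme (over `Spec ℤ`) with a monomorphism into `𝐏ⁿ_ℤ` is projective** — e.g. a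
Grassmannian with its Plücker map, once the map is known to be injective on `T`-points
(Stacks 04XV: proper monomorphism ⇒ closed immersion). [cite: StacksProject, Tag 04XV] -/
theorem terminal_from_of_mono (j : Y ⟶ projectiveSpaceInt ι) [Mono j]
    [IsProper (terminal.from Y)] : IsProjective (terminal.from Y) := by
  obtain ⟨j', hj', hfst⟩ := exists_lift_terminal ι j
  haveI : Mono j' := mono_of_mono_fac hj'
  haveI : IsProper (terminal.from Y) := ‹_›
  exact of_mono_projectiveSpace ι j' hfst

end IsProjective

/-- **A morphism injective on `T`-points for every scheme `T` is a monomorphism** (the criterion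
used for maps defined through their functor of points, e.g. Plücker coordinates).
[cite: StacksProject, Tag 04XV] -/
theorem mono_of_injective_comp {Y P : Scheme.{u}} (j : Y ⟶ P)
    (h : ∀ T : Scheme.{u}, Function.Injective fun g : T ⟶ Y ↦ g ≫ j) : Mono j :=
  ⟨fun _ _ hgg' ↦ h _ hgg'⟩

/-- Conversely a monomorphism is injective on `T`-points. [cite: StacksProject, Tag 04XV] -/
theorem injective_comp_of_mono {Y P : Scheme.{u}} (j : Y ⟶ P) [Mono j] (T : Scheme.{u}) :
    Function.Injective fun g : T ⟶ Y ↦ g ≫ j :=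
  fun _ _ h ↦ (cancel_mono j).mp h

end Literature.AlgebraicGeometry.Morphisms

end
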